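import Summits.CriticalPhenomena.PercolationContinuityZ3.Theorems.PercNearOneGluingNoHeavyPcintBFibFactor
import HarnessLib

/-!
# PCINT lane, T-fibre route PHASE 3 (bond), step (3b): the fibres of the bond fibre process at the ORIGIN step

Cell `prim-pcint`, seat `prim-pcint-1` (gen 13); memo `run/shared/lean/prim/pcint/T-FIBRE-ROUTE.md` (PHASE 3).

Companion of `…PcintBFibFactor.lean` for the step whose selected site is the root `o`: resampling the blocks of the
children edges does not change any fibre test (`fibB_origin_mixG_iff`), and the children report
`meetsU (hOf u e) (rootU o w)` (`outB_origin_mixG_children`).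
-/

noncomputable section

namespace Summit.CriticalPhenomena.PercolationContinuityZ3.Theorems.Pcint

namespace BFib

open Finset AdaptDom EdgeExpl UFib Literature.Probability.Percolation Literature.Probability.LatticeModels

variable {Φ : Type*} [Fintype Φ] {Λ : Finset (Site 2)} {o : ↥Λ} {enc : ↥Λ → ℕ}
  {grow : (Φ × Φ → Bool) → Φ → Finset Φ}

/-! ### The origin step -/

section Origin

variable {n : ℕ} {σ : ↥(EΛ triGraph Λ) → Option Bool} (hcons : traj o enc σ n = σ) (hsel : sel o enc σ = some o)
include hcons hsel

/-- **The fibre tests of the origin step do not read the children blocks**: with `W = blocks of C`,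
`FibB (mixG W u w) ↔ FibB w`. -/
theorem fibB_origin_mixG_iff (u w : (↥Λ ⊕ ↥(EΛ triGraph Λ)) → Blk Φ) :
    FibB o enc grow n σ (mixG ((rule o enc σ).image Sum.inr) u w) ↔ FibB o enc grow n σ w := by
  set W := (rule o enc σ).image (Sum.inr (α := ↥Λ)) with hW
  have hsel' : sel o enc (traj o enc σ n) = some o := by rw [hcons]; exact hsel
  have hinl : ∀ v : ↥Λ, Sum.inl v ∉ W := fun v h => by
    obtain ⟨e, -, he⟩ := mem_image.1 h; exact absurd he (by simp)
  have hexam : ∀ k < n, ∀ e ∈ rule o enc (traj o enc σ k), Sum.inr e ∉ W := by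
    intro k hk e he h
    obtain ⟨e', he', hee'⟩ := mem_image.1 h
    have : e' = e := Sum.inr.inj hee'
    subst this
    have h1 := run_apply_of_mem (rule_unrevealed (o := o) (enc := enc)) (readOut σ) hk he
    have hc := hcons
    unfold traj at h1 hc
    rw [hc] at h1
    exact absurd (rule_unrevealed σ e' he') (by rw [h1]; simp)
  have hloc : ∀ k ≤ n, ∀ v, v ≠ o → usableX o enc grow (mixG W u w) (readOut σ) k v = usableX o enc grow w (readOut σ) k v :=
    usableX_mixG_eq σ W o n (fun v _ => hinl v)
      (fun j hj b v hb hent _ e he => by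
        obtain ⟨e', he'R, he'v, -, -, -⟩ := entered_spec (readOut σ) hb hent
        have : e' = e := Subtype.ext (he'v.trans he.symm)
        exact hexam j hj e (this ▸ he'R))
      (fun j hj b hb hbo => by subst hbo; exact sel_unique (readOut σ) hj hb hsel') (fun h => absurd rfl h) u w
  have hloc' : ∀ k ≤ n, ∀ v, usableX o enc grow (mixG W u w) (readOut σ) k v = usableX o enc grow w (readOut σ) k v := by
    intro k hk v
    by_cases hvo : v = o
    · subst hvo; rw [usableX_root, usableX_root]; unfold rootU; simp only [mixG_of_not_mem (hinl _)]
    · exact hloc k hk v hvo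
  have key : ∀ k < n, ∀ e ∈ rule o enc (traj o enc σ k),
      outB o enc grow (mixG W u w) (traj o enc σ k) e = outB o enc grow w (traj o enc σ k) e := by
    intro k hk e he
    cases hs : sel o enc (traj o enc σ k) with
    | none => rw [outB_none _ hs, outB_none _ hs]
    | some b =>
      have hh : hOf (mixG W u w) e = hOf w e := by funext i; simp only [hOf, mixG_of_not_mem (hexam k hk e he)]
      rw [outB_sel _ hs, outB_sel _ hs, hh, usableAt_sel _ _ hs, usableAt_sel _ _ hs, hloc' k hk.le b]
  constructor
  · intro h k hk e he; rw [← key k hk e he]; exact h k hk e he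
  · intro h k hk e he; rw [key k hk e he]; exact h k hk e he

omit hcons in
/-- **At the origin step the children report `meetsU (hOf u e) (rootU o w)`** (whatever the resampled children blocks). -/
theorem outB_origin_mixG_children (u w : (↥Λ ⊕ ↥(EΛ triGraph Λ)) → Blk Φ) {g : (↥(EΛ triGraph Λ) → Bool) → ℝ}
    (hg : StepTest (rule o enc σ) g) :
    g (outB o enc grow (mixG ((rule o enc σ).image Sum.inr) u w) σ) =
      g (fun e => if e ∈ rule o enc σ then meetsU (hOf u e) (rootU o w) else false) := by
  refine hg.2 _ _ fun e he => ?_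
  have hmem : Sum.inr e ∈ (rule o enc σ).image (Sum.inr (α := ↥Λ)) := mem_image.2 ⟨e, he, rfl⟩
  have hh : hOf (mixG ((rule o enc σ).image Sum.inr) u w) e = hOf u e := by funext i; simp only [hOf, mixG_of_mem hmem]
  have ho : Sum.inl o ∉ (rule o enc σ).image (Sum.inr (α := ↥Λ)) := fun h => by
    obtain ⟨e', -, he'⟩ := mem_image.1 h; exact absurd he' (by simp)
  rw [if_pos he, outB_sel _ hsel, hh, usableAt_root]
  unfold rootU; simp only [mixG_of_not_mem ho]

end Origin

end BFib

end Summit.CriticalPhenomena.PercolationContinuityZ3.Theorems.Pcint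

end
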